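import Summits.RiemannHypothesis.RiemannHypothesis.Theorems.PfPersistenceArithDialSpace
import Summits.RiemannHypothesis.RiemannHypothesis.Theorems.PfPersistenceF5ExactDepth
import HarnessLib

/-!
# PF persistence — the formal TENSOR POWER (Adams map `ψ_m`) on weight tables, the Euler chart, and
table recovery (pub-rhpf barrier-typer gen 13, part 1 of 2; verdict V23 on candidate class C2-N10,
GAP-CLASSES l.1989, '⊗-POWER-STABLE PAIR ∩ 𝓔'; part 2 = `PfPersistencePowerStableReaders`)

**HONEST FRAMING. This is a long-odds MECHANISM SEARCH; no RH claims.** Every statement below is RH-free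
bookkeeping about weight tables and windowed even blocks; nothing decides any Weil positivity. Labels:
PROVED = kernel-checked here; TYPED = a definition; DATA = the cell's numerics (never used below).

## The candidate (cand-2, C2-N10)

`𝒞_⊗(M) := {d ∈ 𝓔 : d is a pair-reader member AND every formal tensor power d^{⊗m} (Euler parameters
c_p ↦ c_p^m, m = 2..M; ζ ↦ ζ) passes the parity grounds at every SERVED core window}`. This file types the
map `d ↦ d^{⊗m}` and the chart `𝓔` it lives on; part 2 proves what intersecting with "all powers pass" can
and cannot do to a windowed reader.

## What is typed / proved

* §1 `powerWeights m` — the formal `m`-th TENSOR POWER `ψ_m` of a weight table RELATIVE TO `ζ`: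
  `ψ_m(w)(q) = ζ(q) · (w(q)/ζ(q))^m`. PROVED: `ψ_m ζ = ζ`, `ψ_0 = ζ`, `ψ_1 = id` on arithmetic tables,
  `ψ_m ∘ ψ_k = ψ_{km}`, `ψ_m` lands in `arithWeights`, a dressing `f` of `ζ` goes to the dressing `f^m`
  (so the dial `K` at `p` goes to the dial `K^m`).
* §2 `eulerWeights c` — the EULER CHART `𝓔`: `w(p^k) = c_p^k · Λ(p^k) p^{-k/2}`; `ψ_m` acts by `c ↦ c^m`
  (cand-2's `c_p ↦ c_p^m` VERBATIM); `eulerDial p K` = the Euler-consistent dial (`p^k ↦ K^k`, all `k`);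
  below `p` it is `ζ`'s table, below `p²` it is the bare dial `dial p K ζ`; hence a window not reaching `p`
  shows `ζ`'s block and the genuine window `(log p, 0)` shows the bare dial's block. PROVED.
* §3 TABLE RECOVERY: `datumOf` is INJECTIVE on origin-free tables (F5-INJ at the window `(log q, q²)`), so
  `ψ_m` is a well-defined self-map of the arithmetic dial space fixing `ζ`, and a class of data defined through
  the table ("`d ∈ 𝓔` all of whose powers …") is an honest subset of `Datum` (`mem_tableClass_iff`). PROVED.
* §3b vocabulary used by part 2 (TYPED): `powerStableCore M S` — the order-`M` ⊗-STABLE CORE of a criterion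
  `S` (arithmetic tables whose `ψ_0 … ψ_M` all have their datum in `S`; cand-2's `𝒞_⊗(M)` pattern);
  `RelClose t B w` — relative `t`-closeness to `ζ` below the cutoff `B`; `AcceptsRelBall S r B`.
-/

set_option linter.dupNamespace false  -- the mandated namespace repeats `RiemannHypothesis`

noncomputable section

open Real Finset Matrix

namespace Summit.RiemannHypothesis.RiemannHypothesis.Theorems.PfPersistence


/-! ## §1 The formal tensor power `ψ_m` relative to `ζ` -/

/-- PROVED: `ζ`'s table vanishes off the prime powers. [folklore] -/
theorem zetaWeights_eq_zero_of_not_isPrimePow {q : ℕ} (hq : ¬ IsPrimePow q) : zetaWeights q = 0 :=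
  zetaWeights_mem_arithWeights q hq

/-- PROVED: `ζ`'s table is positive at every prime power. [folklore] -/
theorem zetaWeights_pos_of_isPrimePow {q : ℕ} (hq : IsPrimePow q) : 0 < zetaWeights q := by
  have hq0 : (0 : ℝ) < q := by exact_mod_cast hq.pos
  unfold zetaWeights
  exact mul_pos (ArithmeticFunction.vonMangoldt_pos_iff.2 hq) (Real.rpow_pos_of_pos hq0 _)

/-- TYPED: the formal `m`-th TENSOR POWER (Adams map `ψ_m`) of a weight table relative to `ζ`:
`ψ_m(w)(q) = ζ(q) · (w(q)/ζ(q))^m` — on the Euler chart `c_p ↦ c_p^m`, `ζ ↦ ζ` (cand-2 C2-N10 `d^{⊗m}`). [this work] -/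
def powerWeights (m : ℕ) (w : Weights) : Weights := fun q => zetaWeights q * (w q / zetaWeights q) ^ m

/-- PROVED: `ψ_m w` vanishes off the prime powers (whatever `w` is). [this work] -/
theorem powerWeights_apply_of_not_isPrimePow (m : ℕ) (w : Weights) {q : ℕ} (hq : ¬ IsPrimePow q) :
    powerWeights m w q = 0 := by
  simp [powerWeights, zetaWeights_eq_zero_of_not_isPrimePow hq]

/-- PROVED: `ψ_m` lands in the arithmetic chart. [this work] -/
theorem powerWeights_mem_arithWeights (m : ℕ) (w : Weights) : powerWeights m w ∈ arithWeights :=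
  fun _ hq => powerWeights_apply_of_not_isPrimePow m w hq

/-- PROVED: `ψ_m ζ = ζ` (the base point is fixed). [this work] -/
theorem powerWeights_zeta (m : ℕ) : powerWeights m zetaWeights = zetaWeights := by
  funext q
  by_cases h : zetaWeights q = 0
  · simp [powerWeights, h]
  · simp [powerWeights, div_self h]

/-- PROVED: `ψ_0 w = ζ`. [this work] -/
theorem powerWeights_zero (w : Weights) : powerWeights 0 w = zetaWeights := by
  funext q; simp [powerWeights]

/-- PROVED: `ψ_1 = id` on arithmetic tables. [this work] -/
theorem powerWeights_one {w : Weights} (hw : w ∈ arithWeights) : powerWeights 1 w = w := by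
  funext q
  by_cases hq : IsPrimePow q
  · have h := (zetaWeights_pos_of_isPrimePow hq).ne'
    simp only [powerWeights, pow_one]
    rw [← mul_div_assoc, mul_div_cancel_left₀ _ h]
  · rw [powerWeights_apply_of_not_isPrimePow 1 w hq, hw q hq]

/-- PROVED: `ψ_m ∘ ψ_k = ψ_{k m}`. [this work] -/
theorem powerWeights_powerWeights (m k : ℕ) (w : Weights) :
    powerWeights m (powerWeights k w) = powerWeights (k * m) w := by
  funext q
  by_cases h : zetaWeights q = 0
  · simp [powerWeights, h]
  · simp only [powerWeights]
    rw [mul_div_cancel_left₀ _ h, pow_mul]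

/-- PROVED: on dressings of `ζ`, `ψ_m` raises the dressing factor to the `m`-th power. [this work] -/
theorem powerWeights_mulWeights_zeta (m : ℕ) (f : ℕ → ℝ) :
    powerWeights m (mulWeights f zetaWeights) = mulWeights (fun q => f q ^ m) zetaWeights := by
  funext q
  by_cases h : zetaWeights q = 0
  · simp [powerWeights, mulWeights, h]
  · simp only [powerWeights, mulWeights]
    rw [mul_div_cancel_right₀ _ h, mul_comm]

/-- PROVED: the `m`-th tensor power of the dial `K` at `p` is the dial `K^m` at `p`. [this work] -/
theorem powerWeights_dial_zeta (m : ℕ) (p : ℕ) (K : ℝ) :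
    powerWeights m (dial p K zetaWeights) = dial p (K ^ m) zetaWeights := by
  rw [dial_eq_mulWeights, dial_eq_mulWeights, powerWeights_mulWeights_zeta]
  congr 1; funext q; split_ifs <;> simp

/-! ## §2 The Euler chart `𝓔` and the Euler-consistent dial -/

/-- TYPED: the EULER CHART — the table of the formal Euler product with local parameters `c_p`:
`w(p^k) = c_p^k · Λ(p^k) p^{-k/2}` (cand-2's `1 + δ_{p^k} = c_p^k`), zero off the prime powers. [this work] -/
def eulerWeights (c : ℕ → ℝ) : Weights :=
  mulWeights (fun q => c q.minFac ^ q.factorization q.minFac) zetaWeights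

/-- PROVED: Euler tables are arithmetic. [this work] -/
theorem eulerWeights_mem_arithWeights (c : ℕ → ℝ) : eulerWeights c ∈ arithWeights :=
  mulWeights_mem_arithWeights _ zetaWeights_mem_arithWeights

/-- PROVED: all parameters `1` is `ζ`. [this work] -/
theorem eulerWeights_one : eulerWeights 1 = zetaWeights := by
  funext q; simp [eulerWeights, mulWeights]

/-- PROVED: the value at a prime power `p^k`, `k ≠ 0`, is `c_p^k ζ(p^k)`. [this work] -/
theorem eulerWeights_apply_prime_pow (c : ℕ → ℝ) {p k : ℕ} (hp : p.Prime) (hk : k ≠ 0) :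
    eulerWeights c (p ^ k) = c p ^ k * zetaWeights (p ^ k) := by
  simp only [eulerWeights, mulWeights, hp.pow_minFac hk, hp.factorization_pow, Finsupp.single_eq_same]

/-- PROVED: zero off the prime powers. [this work] -/
theorem eulerWeights_apply_of_not_isPrimePow (c : ℕ → ℝ) {q : ℕ} (hq : ¬ IsPrimePow q) :
    eulerWeights c q = 0 := by
  simp [eulerWeights, mulWeights, zetaWeights_eq_zero_of_not_isPrimePow hq]

/-- PROVED: `ψ_m` acts on the Euler chart by `c ↦ c^m` (cand-2's `c_p ↦ c_p^m`). [this work] -/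
theorem powerWeights_eulerWeights (m : ℕ) (c : ℕ → ℝ) :
    powerWeights m (eulerWeights c) = eulerWeights (fun p => c p ^ m) := by
  rw [eulerWeights, powerWeights_mulWeights_zeta, eulerWeights]
  congr 1; funext q; exact pow_right_comm _ _ _

/-- TYPED: the EULER-CONSISTENT DIAL at `p` with parameter `K`: every power `p^k` dressed by `K^k`
(the bare `dial p K` dresses `p` alone). [this work] -/
def eulerDial (p : ℕ) (K : ℝ) : Weights := eulerWeights (Function.update 1 p K)

/-- PROVED: Euler dials are arithmetic. [this work] -/
theorem eulerDial_mem_arithWeights (p : ℕ) (K : ℝ) : eulerDial p K ∈ arithWeights :=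
  eulerWeights_mem_arithWeights _

/-- PROVED: `ψ_m (eulerDial p K) = eulerDial p K^m` — the tower of an Euler dial is a ray of Euler dials. [this work] -/
theorem powerWeights_eulerDial (m p : ℕ) (K : ℝ) : powerWeights m (eulerDial p K) = eulerDial p (K ^ m) := by
  rw [eulerDial, powerWeights_eulerWeights, eulerDial]
  congr 1; funext r
  by_cases h : r = p
  · subst h; simp
  · simp [Function.update, h]

/-- PROVED: value `K^k ζ(p^k)` on the powers of `p`. [this work] -/
theorem eulerDial_apply_pow_self {p : ℕ} (hp : p.Prime) (K : ℝ) {k : ℕ} (hk : k ≠ 0) :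
    eulerDial p K (p ^ k) = K ^ k * zetaWeights (p ^ k) := by
  simp [eulerDial, eulerWeights_apply_prime_pow _ hp hk]

/-- PROVED: value `K ζ(p)` at `p`. [this work] -/
theorem eulerDial_apply_self {p : ℕ} (hp : p.Prime) (K : ℝ) : eulerDial p K p = K * zetaWeights p := by
  simpa using eulerDial_apply_pow_self hp K one_ne_zero

/-- PROVED: value `ζ(r^k)` on the powers of every other prime `r`. [this work] -/
theorem eulerDial_apply_pow_of_ne {p r : ℕ} (hr : r.Prime) (hrp : r ≠ p) (K : ℝ) {k : ℕ} (hk : k ≠ 0) :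
    eulerDial p K (r ^ k) = zetaWeights (r ^ k) := by
  simp [eulerDial, eulerWeights_apply_prime_pow _ hr hk, Function.update, hrp]

/-- PROVED: an Euler dial with `K ≠ 1` is not `ζ`'s table (it moves the entry at `p`). [this work] -/
theorem eulerDial_ne_zetaWeights {p : ℕ} (hp : p.Prime) {K : ℝ} (hK : K ≠ 1) : eulerDial p K ≠ zetaWeights := by
  intro h
  have h1 := congrFun h p
  rw [eulerDial_apply_self hp] at h1
  exact hK (mul_right_cancel₀ (zetaWeights_pos_of_prime hp).ne' (by rw [one_mul]; exact h1))

/-- PROVED (locality input): below `p` the Euler dial at `p` IS `ζ`'s table. [this work] -/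
theorem eulerDial_eq_zeta_below {p : ℕ} (hp : p.Prime) (K : ℝ) {q : ℕ} (hq : q < p) :
    eulerDial p K q = zetaWeights q := by
  by_cases hpp : IsPrimePow q
  · obtain ⟨r, k, hr, hk, rfl⟩ := (isPrimePow_nat_iff _).1 hpp
    by_cases hrp : r = p
    · subst hrp
      exact absurd hq (not_lt.2 (le_self_pow₀ hr.one_lt.le hk.ne'))
    · exact eulerDial_apply_pow_of_ne hr hrp K hk.ne'
  · rw [eulerDial, eulerWeights_apply_of_not_isPrimePow _ hpp, zetaWeights_eq_zero_of_not_isPrimePow hpp]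

/-- PROVED (the witness window's input): below `p²` the Euler dial at `p` IS the bare dial `dial p K ζ`
(the only power of `p` below `p²` is `p`). [this work] -/
theorem eulerDial_eq_dial_below {p : ℕ} (hp : p.Prime) (K : ℝ) {q : ℕ} (hq : q < p ^ 2) :
    eulerDial p K q = dial p K zetaWeights q := by
  by_cases hpp : IsPrimePow q
  · obtain ⟨r, k, hr, hk, rfl⟩ := (isPrimePow_nat_iff _).1 hpp
    by_cases hrp : r = p
    · subst hrp
      have hk2 : k < 2 := (pow_lt_pow_iff_right₀ hr.one_lt).1 hq
      obtain rfl : k = 1 := by omega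
      simp [eulerDial_apply_self hr K, dial]
    · have hne : r ^ k ≠ p := fun h => hrp (hp.pow_eq_iff.1 h).1
      rw [eulerDial_apply_pow_of_ne hr hrp K hk.ne']
      simp [dial, hne]
  · rw [eulerDial, eulerWeights_apply_of_not_isPrimePow _ hpp]
    simp [dial, zetaWeights_eq_zero_of_not_isPrimePow hpp]

/-- PROVED (LOCALITY for Euler dials): a window not reaching `p` (`e^{2a} ≤ p`) shows `ζ`'s block. [this work] -/
theorem evenBlock_eulerDial_of_le {p : ℕ} (hp : p.Prime) (K : ℝ) {win : Window}
    (hwin : Real.exp (2 * win.a) ≤ p) : evenBlock (eulerDial p K) win = evenBlock zetaWeights win :=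
  evenBlock_eq_of_eq_below win hwin fun q hq => eulerDial_eq_zeta_below hp K (by exact_mod_cast hq)

/-- PROVED: `e^{2 · log p} = p²` — the genuine window `(log p, 0)` reaches exactly `p²` (endpoint invisible). [folklore] -/
theorem exp_two_mul_logWindow_a {p : ℕ} (hp : p.Prime) :
    Real.exp (2 * (logWindow p hp.two_le).a) = (p : ℝ) ^ 2 := by
  have hp0 : (0 : ℝ) < p := by exact_mod_cast hp.pos
  rw [logWindow_a, show (2 : ℝ) * Real.log p = Real.log ((p : ℝ) ^ 2) by rw [Real.log_pow]; norm_num,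
    Real.exp_log (pow_pos hp0 2)]

/-- PROVED: at the genuine window `(log p, 0)` the Euler dial and the bare dial have the SAME block. [this work] -/
theorem evenBlock_eulerDial_logWindow {p : ℕ} (hp : p.Prime) (K : ℝ) :
    evenBlock (eulerDial p K) (logWindow p hp.two_le)
      = evenBlock (dial p K zetaWeights) (logWindow p hp.two_le) :=
  evenBlock_eq_of_eq_below _ (X := (p : ℝ) ^ 2) (exp_two_mul_logWindow_a hp).le
    fun q hq => eulerDial_eq_dial_below hp K (by exact_mod_cast hq)

/-! ## §3 Table recovery: `ψ_m` and table-defined classes are honest functionals of the datum -/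

/-- TYPED: the RECOVERY WINDOW of a position `q ≥ 2`: `(log q, q²)` — genuine, reach `e^{2a} = q²`,
rank `⌊e^{2a}⌋ = q² ≤ N + 1`. [this work] -/
def recoveryWindow (q : ℕ) (hq : 2 ≤ q) : Window :=
  ⟨Real.log q, q ^ 2, Real.log_pos (by exact_mod_cast (by omega : 1 < q))⟩

/-- PROVED: the recovery window has enough rank for F5-INJ. [this work] -/
theorem floor_exp_recoveryWindow (q : ℕ) (hq : 2 ≤ q) :
    ⌊Real.exp (2 * (recoveryWindow q hq).a)⌋₊ ≤ (recoveryWindow q hq).N + 1 := by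
  have hq0 : (0 : ℝ) < q := by exact_mod_cast (by omega : 0 < q)
  have h : Real.exp (2 * (recoveryWindow q hq).a) = ((q ^ 2 : ℕ) : ℝ) := by
    show Real.exp (2 * Real.log q) = _
    rw [show (2 : ℝ) * Real.log q = Real.log ((q : ℝ) ^ 2) by rw [Real.log_pow]; norm_num,
      Real.exp_log (pow_pos hq0 2)]
    push_cast; ring
  rw [h, Nat.floor_natCast]
  show q ^ 2 ≤ q ^ 2 + 1
  omega

/-- **PROVED (TABLE RECOVERY).** `datumOf` is INJECTIVE on origin-free tables: the datum determines the table
(position `q ≥ 2` is read off the window `(log q, q²)` by F5-INJ, `weights_eq_of_evenBlock_eq_of_floor_le`;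
positions `0, 1` are the junk positions fixed by origin-freeness). Hence every functional OF THE TABLE — `ψ_m`,
"`d ∈ 𝓔`", "all powers of `d` pass" — is a well-defined functional OF THE DATUM on the chart. [this work] -/
theorem datumOf_injOn_originFreeWeights : Set.InjOn datumOf originFreeWeights := by
  intro w hw w' hw' h
  funext q
  by_cases hq : 2 ≤ q
  · have hlog : Real.log q < 2 * (recoveryWindow q hq).a := by
      show Real.log q < 2 * Real.log q
      linarith [Real.log_pos (show (1 : ℝ) < q by exact_mod_cast (by omega : 1 < q))]
    exact weights_eq_of_evenBlock_eq_of_floor_le (recoveryWindow q hq) (floor_exp_recoveryWindow q hq)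
      (hw.1.trans hw'.1.symm) (hw.2.trans hw'.2.symm)
      (by simpa [datumOf] using congrFun h (recoveryWindow q hq)) q hq hlog
  · interval_cases q
    · exact hw.1.trans hw'.1.symm
    · exact hw.2.trans hw'.2.symm

/-- PROVED: injective on the arithmetic chart. [this work] -/
theorem datumOf_injOn_arithWeights : Set.InjOn datumOf arithWeights :=
  datumOf_injOn_originFreeWeights.mono arithWeights_subset_originFreeWeights

/-- PROVED: an origin-free table has `ζ`'s datum iff it IS `ζ`'s table. [this work] -/
theorem datumOf_eq_zetaDatum_iff {w : Weights} (hw : w ∈ originFreeWeights) :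
    datumOf w = zetaDatum ↔ w = zetaWeights :=
  ⟨fun h => datumOf_injOn_originFreeWeights hw
      (arithWeights_subset_originFreeWeights zetaWeights_mem_arithWeights) h,
    fun h => h ▸ rfl⟩

/-- PROVED: a TABLE-DEFINED class of arithmetic data is an honest subset of `Datum` — membership of
`datumOf w` is `P w` (no two arithmetic tables share a datum). [this work] -/
theorem mem_tableClass_iff (P : Weights → Prop) {w : Weights} (hw : w ∈ arithWeights) :
    datumOf w ∈ datumOf '' {w' | w' ∈ arithWeights ∧ P w'} ↔ P w := by
  constructor
  · rintro ⟨w', ⟨hw', hP⟩, h⟩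
    rwa [datumOf_injOn_arithWeights hw' hw h] at hP
  · exact fun hP => ⟨w, ⟨hw, hP⟩, rfl⟩

/-! ## §3b Vocabulary for part 2: the ⊗-stable core of a criterion, relative balls at `ζ` -/

/-- TYPED: the ORDER-`M` ⊗-STABLE CORE of a criterion `S` on the arithmetic chart (cand-2's `𝒞_⊗(M)` pattern,
C2-N10): tables whose tensor powers `ψ_0, …, ψ_M` all have their datum in `S` (`ψ_0 = ζ`, `ψ_1 = ` the table). [this work] -/
def powerStableCore (M : ℕ) (S : Set Datum) : Set Weights :=
  {w | w ∈ arithWeights ∧ ∀ m, m ≤ M → datumOf (powerWeights m w) ∈ S}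

/-- PROVED: `ζ` is in the core of every order of every criterion accepting it. [this work] -/
theorem zetaWeights_mem_powerStableCore {S : Set Datum} (hζ : zetaDatum ∈ S) (M : ℕ) :
    zetaWeights ∈ powerStableCore M S :=
  ⟨zetaWeights_mem_arithWeights, fun m _ => by rw [powerWeights_zeta]; exact hζ⟩

/-- TYPED: RELATIVE `t`-CLOSENESS to `ζ` below the cutoff `B`: `|w(q) − ζ(q)| ≤ t ζ(q)` for `q ≤ B`
(on the Euler chart: `|c_p^k − 1| ≤ t` for `p^k ≤ B`). [this work] -/
def RelClose (t : ℝ) (B : ℕ) (w : Weights) : Prop := ∀ q, q ≤ B → |w q - zetaWeights q| ≤ t * zetaWeights q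

/-- PROVED: monotone in the radius. [this work] -/
theorem RelClose.mono {t t' : ℝ} {B : ℕ} {w : Weights} (h : RelClose t B w) (htt' : t ≤ t') :
    RelClose t' B w :=
  fun q hq => (h q hq).trans (mul_le_mul_of_nonneg_right htt' (zetaWeights_nonneg q))

/-- TYPED: the reader ACCEPTS THE RELATIVE `r`-BALL BELOW `B`: every arithmetic table relatively `r`-close to
`ζ` at the positions `q ≤ B` has its datum in `S` (what a served-window reader holding at `ζ` with a margin —
`FinitelyRobustAt` — does, `B` = its largest reach). [this work] -/
def AcceptsRelBall (S : Set Datum) (r : ℝ) (B : ℕ) : Prop :=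
  ∀ w ∈ arithWeights, RelClose r B w → datumOf w ∈ S

end Summit.RiemannHypothesis.RiemannHypothesis.Theorems.PfPersistence
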